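import Summits.BirchSwinnertonDyer.BirchSwinnertonDyer.Theorems.UniversalToricDescentToricKernelAtThreeApZeroOdd
import Summits.BirchSwinnertonDyer.BirchSwinnertonDyer.Theorems.UniversalToricDescentWildSplitControlAtThreeOfPoitouTate
import HarnessLib

/-!
# Route `UniversalToricDescent` — the rev-27 kernel `ToricKernelAtThreeApZeroOdd` (item 24477, CLOSED by
# `toricKernelAtThreeApZeroOdd_proof`) with crux #5 `WildSplitControlAtThree` (item 20386) consumed THROUGH ITS
# TWO PRINTED POITOU–TATE LEAVES (items 20461 / 20462) BY NAME

Cell `bsd-wall` (W-ALL lane 3, row 2·3@3), seat `bsd-wall-utd-p3` g7, 2026-08-28. `--supports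
stmt-BirchSwinnertonDyer-20386`.

Crux #5 (Jetchev–Skinner–Wan's anticyclotomic control count at the potentially supersingular split `3`) was
split (gen 1) into seven published-fact leaves + the glue `WildSplitControlAtThreeOfPublishedFacts` (item 20468,
CLOSED); five leaves are tree THEOREMS (20463–20467, all CLOSED — the last one, Serre 1967 §5 Prop. 8, by
utd-p3 g5), and `UniversalToricDescentControl.wildSplitControlAtThree_of_poitouTate` (utd-p3 g5) gives crux #5
from the two remaining leaves ALONE: `PoitouTateSelmerStructureDualityFact` (item 20461 = Milne ADT I
Thm. 4.10(b) / Howard 2004 Thm. 2.1.11, `∀ K, poitouTate_selmerStructure_duality K`) and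
`PoitouTateShaTateDualFact` (item 20462 = Milne ADT I Thm. 4.10(a), `∀ K, poitouTate_sha_tateDual K`) — both
cite-level textbook class field theory, typed as Literature named facts.

This file substitutes that into the landed kernel:

* `toricKernelAtThreeApZeroOdd_of_poitouTate` — item 24477's text with the arrow `WildSplitControlAtThree →`
  replaced by `PoitouTateSelmerStructureDualityFact → PoitouTateShaTateDualFact →` (the texts of items 20461,
  20462 by name). If the steward re-keys the kernel this way (crux #5 displayed as print, like the package
  24476 for crux #4), this theorem closes the re-keyed item by `exact`.
* `wAllExclAddWildRankOneSurjTwin_of_apZeroBuckets_of_print_of_poitouTate` — the corresponding `closes` body: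
  the leaf `WAllExclAddWildRankOneSurjTwin` from the route's rev-28 top-level items with `hC : WildSplitControlAtThree`
  replaced by the two Poitou–Tate facts.

HONEST FRAMING: pure logic (two `exact`s over landed theorems); CONDITIONAL on every displayed hypothesis — the
research cruxes #2 (transport 20186 ⟸ 20395 ∧ 21845), #3 (bucket B 20694, bucket C `a₃ = 0` 23594), #6 (rank-zero
wild leaf 20387), the E-port 24475, and the printed inputs (20389's six facts, 20692, 24476, and now Poitou–Tate
×2); nothing closes by this file; item 20386 itself stays open until its two fact leaves are FORMALISED. BSD is
proved for no curve here. No definition, no named fact, no `sorry`. Beyond-print theorem: NO.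

References: [JetchevSkinnerWan2017] Thm. 3.3.1, §7.4.1; [MilneADT2006] I Thm. 4.10; [Serre1967GroupesPDivisibles]
§5 Prop. 8.
-/

set_option linter.dupNamespace false
set_option autoImplicit false

namespace Summit.BirchSwinnertonDyer.BirchSwinnertonDyer.Theorems.UniversalToricDescentKernelOdd

open Summit.BirchSwinnertonDyer.BirchSwinnertonDyer.Theses.UniversalToricDescent
  Summit.BirchSwinnertonDyer.BirchSwinnertonDyer.Theorems

/-- **The rev-27 kernel with crux #5 keyed to its two Poitou–Tate leaves.** Item 24477's text verbatim except
that `WildSplitControlAtThree →` is replaced by `PoitouTateSelmerStructureDualityFact → PoitouTateShaTateDualFact →`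
(items 20461, 20462 by name); proof = `toricKernelAtThreeApZeroOdd_proof` with `hC` supplied by utd-p3 g5's
`UniversalToricDescentControl.wildSplitControlAtThree_of_poitouTate`. CONDITIONAL; closes nothing.
[cite: JetchevSkinnerWan2017, Thm. 3.3.1 (arXiv:1512.06894 p. 11)] [cite: MilneADT2006, Ch. I, Thm. 4.10] -/
theorem toricKernelAtThreeApZeroOdd_of_poitouTate :
    ToricPublishedInputs → ToricTransportModThree → TwinSplitIMCAtThreePrintedFacts →
    TwinSplitIMCAtThreeGoodOrdOfPrint → TwinSplitIMCAtThreeMult → TwinSplitIMCAtThreeGoodSSApZero →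
    GoodSSApZeroTwinSupplyAtThree → WildSplitPrintedInputsAtThree → WildSplitFrameAtThreeOddOfPrint →
    PoitouTateSelmerStructureDualityFact → PoitouTateShaTateDualFact → WildRankZeroTwistAtThree →
    ∀ (W : WeierstrassCurve ℚ) [W.IsElliptic] [W.IsGloballyMinimal],
      Summit.BirchSwinnertonDyer.Rank1Residual.Additive.ClassO6 W 3 → W.analyticRank = 1 →
      W.HasSurjectiveModNGaloisRep 3 →
      (∃ (W' : WeierstrassCurve ℚ) (_ : W'.IsElliptic) (_ : W'.IsGloballyMinimal),
        Summit.BirchSwinnertonDyer.Rank1Residual.O6.ModPCongruent W' W 3 ∧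
        ¬ Literature.NumberTheory.EllipticCurves.Rank1Residual.Addv W' 3 ∧ W'.HasSurjectiveModNGaloisRep 3) →
      Literature.NumberTheory.EllipticCurves.BSDp W 3 :=
  fun hF hT hP hA hB hS0 hsupply hW hS h1 h2 hZ ↦
    toricKernelAtThreeApZeroOdd_proof hF hT hP hA hB hS0 hsupply hW hS
      (UniversalToricDescentControl.wildSplitControlAtThree_of_poitouTate h1 h2) hZ

/-- **The would-be `closes` body with crux #5 keyed to print**: the leaf `WAllExclAddWildRankOneSurjTwin` from the
route's rev-28 top-level items — published inputs (20389), transport #2 (20186), the bucket package #3 (23651),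
the `a₃ = 0` twin supply (23595, CLOSED), the printed package of #4 (24476), the E-port ♯ (24475), the rank-zero
wild leaf #6 (20387) — and the two Poitou–Tate facts (20461, 20462) IN PLACE OF crux #5 (20386).
CONDITIONAL; closes nothing. [folklore] -/
theorem wAllExclAddWildRankOneSurjTwin_of_apZeroBuckets_of_print_of_poitouTate
    (hF : ToricPublishedInputs) (hT : ToricTransportModThree) (h3 : TwinSplitIMCAtThreeApZeroBuckets)
    (hsupply : GoodSSApZeroTwinSupplyAtThree) (hW : WildSplitPrintedInputsAtThree)
    (hS : WildSplitFrameAtThreeOddOfPrint) (h1 : PoitouTateSelmerStructureDualityFact)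
    (h2 : PoitouTateShaTateDualFact) (hZ : WildRankZeroTwistAtThree) :
    Summit.BirchSwinnertonDyer.WAllExclAddWildRankOneSurjTwin := by
  obtain ⟨hP, hA, hB, hS0⟩ := h3
  exact Summit.BirchSwinnertonDyer.wAllExclAddWildRankOneSurjTwin_of_forall
    (toricKernelAtThreeApZeroOdd_of_poitouTate hF hT hP hA hB hS0 hsupply hW hS h1 h2 hZ)

end Summit.BirchSwinnertonDyer.BirchSwinnertonDyer.Theorems.UniversalToricDescentKernelOdd
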